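import Literature.Barriers.QuantumAdvantage.SupremacyTheoremsNonRelativizingAssembly
import Literature.Barriers.QuantumAdvantage.AaronsonChenLem53Holds
import Literature.Barriers.QuantumAdvantage.AaronsonChenCor52Holds
import HarnessLib

/-!
# `SupremacyTheoremsNonRelativizing` — DISCHARGED (Fortnow–Rogers 1999, Cor. 3.7 and Thm. 4.2; Aaronson–Chen 2017, Cor. 5.2)

Third proof file (theorems only; D-0014 append protocol) of the barrier entry
`SupremacyTheoremsNonRelativizing.lean` (D-0021),
`SupremacyTheoremsNonRelativizing := fortnowRogers1999_cor37 ∧ fortnowRogers1999_thm42 ∧ aaronsonChen2017_cor52`.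
`SupremacyTheoremsNonRelativizingAssembly.lean` (rev. 5) reduced the barrier fact, by proof, to ONE
frontier fact, the `SampBPP^{TQBF,O}` machine of Aaronson–Chen's Lemma 5.3
(`aaronsonChen2017_lem53_machine`, `AaronsonChenSimulation.lean`: the printed sentence "it is not
hard to see that all the computations can be done in `PSPACE`, and therefore can be implemented in
`poly(n, 1/ε)` time with the help of the `TQBF` oracle. So `A` is a `SampBPP` algorithm",
[AaronsonChen2017, §5.3 p. 23]). That fact is now a theorem of the tree,
`aaronsonChen2017_lem53_machine_holds` (`AaronsonChenLem53Holds.lean`: the machine of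
`AaronsonChenMachine.lean` run with a Karp reduction of its advice language to `TQBF`,
`TQBFRed.isHard_PSPACE_TQBF`, the advice language being in `PSPACE` by `AcProto.advLang_mem_PSPACE`
and the two physical predicates of `AaronsonChenPhysicsPSPACE.lean`), and so is Cor. 5.2,
`aaronsonChen2017_cor52_holds` (`AaronsonChenCor52Holds.lean`).

Main results: **`SupremacyTheoremsNonRelativizing_holds`** — the barrier fact with no hypothesis
left (`SupremacyTheoremsNonRelativizing.of_frontier₁` fed with `aaronsonChen2017_lem53_machine_holds`),
the conjunct-by-conjunct form `SupremacyTheoremsNonRelativizing_holds'`, and the hypothesis-free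
no-go summary **`SupremacyTheoremsNonRelativizing.summary_canonical_holds`** over the tree's
technique class `Literature.Barriers.PneNP.Relativizes` (fed with the tree fact
`PRel_subset_BPPRel_holds`). Nothing is restated: every part is imported and used at its tree name.

Revision 2 (2026-08-15): rev. 1 of this file also carried one-line discharges named
`aaronsonChen2017_lem53_machine_holds` and `aaronsonChen2017_cor52_holds`; the sibling proof files
`AaronsonChenLem53Holds.lean` / `AaronsonChenCor52Holds.lean` landed the same fully-qualified names
within the same minute, so this file now imports those modules and uses their theorems (same terms),
keeping the umbrella `Literature` import free of duplicate declarations.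

## Sources

* [FortnowRogers1999JCSS] L. Fortnow, J. Rogers, *Complexity limitations on quantum computation*,
  JCSS 59 (1999) (arXiv:cs/9811023, held; arXiv numbering): Cor. 3.7 (p. 5), Thm. 4.2 (p. 7).
* [AaronsonChen2017] S. Aaronson, L. Chen, *Complexity-theoretic foundations of quantum supremacy
  experiments*, CCC 2017 (arXiv:1612.05903, held): Thm. 5.1, Cor. 5.2, Lemma 5.3 (p. 21), §5.3
  (pp. 21–23, esp. p. 23 "So A is a SampBPP algorithm").
* [AroraBarakCC2009] Thm. 4.13 (`TQBF` is `PSPACE`-complete), §3.4 (relativizing results).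
-/

noncomputable section

namespace Literature.Barriers.QuantumAdvantage

open _root_.Computability Literature.Computability.Complexity Literature.Computability.Complexity.Classes
  Literature.Computability.Cryptography Literature.Computability.QuantumComplexity PneNP

/-- **`SupremacyTheoremsNonRelativizing` — DISCHARGED**: the conjunction of Fortnow–Rogers 1999,
Cor. 3.7 (`fortnowRogers1999_cor37_holds`, `FortnowRogersBrainWorld.lean`) and Thm. 4.2
(`fortnowRogers1999_thm42_holds`), and Aaronson–Chen 2017, Cor. 5.2, via
`SupremacyTheoremsNonRelativizing.of_frontier₁` fed with the discharged `SampBPP^{TQBF,O}` machine of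
Lemma 5.3 (`aaronsonChen2017_lem53_machine_holds`, `AaronsonChenLem53Holds.lean`).
[cite: FortnowRogers1999JCSS, Cor. 3.7 and Thm. 4.2 (arXiv numbering)] [cite: AaronsonChen2017, Cor. 5.2 (p. 21) and Lemma 5.3 (§5.3 p. 23)] -/
theorem SupremacyTheoremsNonRelativizing_holds : SupremacyTheoremsNonRelativizing :=
  SupremacyTheoremsNonRelativizing.of_frontier₁ aaronsonChen2017_lem53_machine_holds

/-- The three printed oracle facts, conjunct by conjunct, with no hypothesis
(`fortnowRogers1999_cor37_holds`, `fortnowRogers1999_thm42_holds`, `aaronsonChen2017_cor52_holds`).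
[cite: FortnowRogers1999JCSS, Cor. 3.7 and Thm. 4.2 (arXiv numbering)] [cite: AaronsonChen2017, Cor. 5.2 (p. 21)] -/
theorem SupremacyTheoremsNonRelativizing_holds' :
    fortnowRogers1999_cor37 ∧ fortnowRogers1999_thm42 ∧ aaronsonChen2017_cor52 :=
  ⟨fortnowRogers1999_cor37_holds, fortnowRogers1999_thm42_holds, aaronsonChen2017_cor52_holds⟩

/-- **The no-go readings with no hypothesis left**: over the tree's technique class `Relativizes`,
none of the three templates — (a) "`BQP^O ⊆ BPP^O ⟹ PH^O` collapses", (b) the strong supremacy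
theorem "`SampBQP^O ⊆ SampBPP^O ⟹ PH^O` collapses", (c) "`P^O ≠ UP^O ∩ coUP^O ⟹ BQP^O ⊄ BPP^O`" —
relativizes, for the canonical presentations `bqpRelOf`, `sampBQPRelOf`
(`SupremacyTheoremsNonRelativizing.summary_canonical` fed with the discharged barrier fact and the
tree fact `PRel_subset_BPPRel_holds`). [cite: FortnowRogers1999JCSS, Cor. 3.7, Thm. 4.1 and Thm. 4.2 (arXiv numbering)] [cite: AaronsonChen2017, Cor. 5.2 and §1 (p. 8)] [cite: AroraBarakCC2009, §3.4] -/
theorem SupremacyTheoremsNonRelativizing.summary_canonical_holds :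
    (¬ Relativizes fun O => bqpRelOf O ⊆ BPPRel O → ¬ IsInfinitePHRel O) ∧
      (¬ Relativizes fun O => sampBQPRelOf O ⊆ SampPRel O → ¬ IsInfinitePHRel O) ∧
        ¬ Relativizes fun O => PRel O ≠ UPRel O ∩ coUPRel O → ¬ bqpRelOf O ⊆ BPPRel O :=
  SupremacyTheoremsNonRelativizing_holds.summary_canonical PRel_subset_BPPRel_holds

end Literature.Barriers.QuantumAdvantage

end
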